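import Summits.CriticalPhenomena.PercolationContinuityZ3.Theorems.Transplant.DiamondFilmSqShadowX
import HarnessLib

/-!
# The diamond `(001)`-films of ODD thickness are RIGID IN THE AXES: every graph automorphism of `D_k` (`k` odd) maps `u`-bonds to `u`-bonds and
# `v`-bonds to `v`-bonds; hence no automorphism lifts a quarter turn of the planar shadow, and the square-shadow DST interface «SqShadowDefs».`SqShadow`
# has NO instance on `D_k` with the planar shadow `uv`

builds on p205010 (kernel theorem, internal audit signed; external expert review pending) — NOT used in this file.
Lane `prim-bschramm`, seat `prim-bschramm-p2` (gen 44; class C1b = films / other 3D lattices at their own critical point, METHOD = input substitution;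
memo `HOME/bschramm/P2-LATTICES.md` §142 (4), §154); helper file (`--supports stmt-CriticalPhenomena-4575 --as helper`).

WHY.  After gen 43 the p205010-free residue of TARGET 2x is `DiamondFilmOwnCriticalContinuity k` for odd `k ≥ 5` (and even `k ≥ 12`, routine).  The even
films carry the quarter turn ∘ level flip («DiamondFilmQuarterTurn».`rotFlipIso`) and Duminil-Copin–Sidoravicius–Tassion's argument transplants
(«SqShadow*», «DkSK*»).  The memo's verdict "method-void for odd `k`: only the rectangle group acts" (§142 (4)) is made a KERNEL FACT here:
* §1 the AXIS OF A BOND from heights: a bond `{x, y}` of `D_k` is a `u`-step (`uv x 1 = uv y 1`) iff `x₂ + y₂ ≡ 1 (4)` (lower endpoint of even height),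
  else a `v`-step (`uv x 0 = uv y 0`);
* §2 NEIGHBOUR COUNTS: a vertex of a boundary layer (`x₂ ∈ {0, k}`) has at most two neighbours, an interior vertex at least three;
* §3 every automorphism preserves the boundary layers and the DISTANCE TO THE BOUNDARY `min x₂ (k − x₂)` (induction on the distance);
* §4 for ODD `k` the axis of a bond is a function of the two boundary distances of its endpoints (the layer pairs `{h, h+1}` and `{k−h−1, k−h}` exchanged by
  the level flip have the SAME axis iff `k` is odd), so **`uv_one_eq_iff_of_iso`**: every automorphism maps `u`-bonds onto `u`-bonds; **`not_exists_rot_lift`**: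
  no automorphism `α` and centre `c` with `uv (α w) − c = sqRot90 (uv w − c)`; **`sqShadow_sh_ne_uv`** / **`sqShadow_sh_ne_linear_uv`**: no `Ψ : SqShadow (D_k)`
  has `Ψ.sh = uv` or `Ψ.sh = A ∘ uv + t` (`A` injective additive) — the `D₄` input of DST's proof (the field `SqShadow.rot`, used for the boundary cover of Lemma 4
  «SqShadowSide».`sqRing_subset_iUnion_side` and the direction swap «SqShadowTransport».`real_goodEvent_one_eq`) is unavailable (even `k`: «DiamondFilmSqShadow».`sqShadow`).
What this does NOT say: that `θ(p_c) > 0`, or that no other route exists — memo §154 records the anisotropic (`D₂ ⋉ ℤ²`) variant of DST and its open node.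
[cite: DuminilCopinSidoraviciusTassion2016, §2 (p. 2 "invariant under π/2-rotation and reflection"; Lemma 4; §2.2)] [cite: ConwaySloane1999, Ch. 4 §7.3]
[cite: BenjaminiSchramm1996, Conj. 4 / Question 3]
-/

noncomputable section

namespace Summit.CriticalPhenomena.PercolationContinuityZ3.Theorems.Transplant

open Literature.Probability.Percolation Literature.Probability.LatticeModels SimpleGraph

namespace DiamondFilm

variable {k : ℕ}

/-! ## §1 The axis of a bond from the heights of its endpoints -/

/-- Along a bond of `D_k` the height changes by `±1`. [cite: ConwaySloane1999, Ch. 4 §7.3] -/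
theorem height_step {x y : diamondFilm k} (h : (diamondGraph.induce (diamondFilm k)).Adj x y) :
    crd x 2 - crd y 2 = 1 ∨ crd x 2 - crd y 2 = -1 :=
  ((adj_crd_iff x y).1 h).2.2

set_option maxHeartbeats 400000 in
/-- **The axis of a bond is read off the heights**: a bond `{x, y}` of `D_k` keeps the second shadow coordinate (`u`-step) iff `x₂ + y₂ ≡ 1 (mod 4)`,
i.e. iff its lower endpoint has even height (from an even site the bonds going up are `(σ, σ, 1)`). [cite: ConwaySloane1999, Ch. 4 §7.3] -/
theorem uv_one_eq_iff_heights {x y : diamondFilm k} (h : (diamondGraph.induce (diamondFilm k)).Adj x y) :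
    uv x 1 = uv y 1 ↔ (crd x 2 + crd y 2) % 4 = 1 := by
  obtain ⟨px0, px1, px2, -, -⟩ := crd_facts x
  obtain ⟨py0, py1, py2, -, -⟩ := crd_facts y
  obtain ⟨-, ex1⟩ := uv_apply x
  obtain ⟨-, ey1⟩ := uv_apply y
  obtain ⟨h0, h1, h2⟩ := (adj_crd_iff x y).1 h
  rw [ex1, ey1]
  rcases px2 with px2 | px2 <;> rcases py2 with py2 | py2 <;> rcases h0 with h0 | h0 <;> rcases h1 with h1 | h1 <;>
    rcases h2 with h2 | h2 <;> omega

/-- **The other axis**: a bond keeps the first shadow coordinate (`v`-step) iff `x₂ + y₂ ≡ 3 (mod 4)` (lower endpoint of odd height).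
[cite: ConwaySloane1999, Ch. 4 §7.3] -/
theorem uv_zero_eq_iff_heights {x y : diamondFilm k} (h : (diamondGraph.induce (diamondFilm k)).Adj x y) :
    uv x 0 = uv y 0 ↔ (crd x 2 + crd y 2) % 4 = 3 := by
  obtain ⟨px0, px1, px2, -, -⟩ := crd_facts x
  obtain ⟨py0, py1, py2, -, -⟩ := crd_facts y
  obtain ⟨ex0, -⟩ := uv_apply x
  obtain ⟨ey0, -⟩ := uv_apply y
  obtain ⟨h0, h1, h2⟩ := (adj_crd_iff x y).1 h
  rw [ex0, ey0]
  rcases px2 with px2 | px2 <;> rcases py2 with py2 | py2 <;> rcases h0 with h0 | h0 <;> rcases h1 with h1 | h1 <;>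
    rcases h2 with h2 | h2 <;> omega

/-! ## §2 Neighbour counts: boundary layers versus interior layers -/

/-- **Two neighbours of a vertex at the same height and with the same first coordinate coincide** (the diamond arithmetic `x₀ + x₁ + x₂ ≡ 0, 3 (4)`
fixes the second coordinate). [cite: ConwaySloane1999, Ch. 4 §7.3] -/
theorem nbr_eq_of_crd_eq {x y y' : diamondFilm k} (hy : (diamondGraph.induce (diamondFilm k)).Adj x y)
    (hy' : (diamondGraph.induce (diamondFilm k)).Adj x y') (h2 : crd y 2 = crd y' 2) (h0 : crd y 0 = crd y' 0) : y = y' := by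
  obtain ⟨-, -, py2, -, -⟩ := crd_facts y
  obtain ⟨-, -, qy2, -, -⟩ := crd_facts y'
  obtain ⟨a0, a1, a2⟩ := (adj_crd_iff x y).1 hy
  obtain ⟨b0, b1, b2⟩ := (adj_crd_iff x y').1 hy'
  have h1 : crd y 1 = crd y' 1 := by
    rcases py2 with py2 | py2 <;> rcases qy2 with qy2 | qy2 <;> rcases a1 with a1 | a1 <;> rcases b1 with b1 | b1 <;> omega
  refine ext_crd fun i => ?_
  fin_cases i
  · exact h0
  · exact h1
  · exact h2

/-- **A vertex all of whose neighbours lie at one height has at most two neighbours** (their first coordinates are `x₀ ± 1`). [cite: ConwaySloane1999, Ch. 4 §7.3] -/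
theorem at_most_two_nbrs_of_height {x : diamondFilm k} {ℓ : ℤ} (hℓ : ∀ y, (diamondGraph.induce (diamondFilm k)).Adj x y → crd y 2 = ℓ)
    {y₁ y₂ y₃ : diamondFilm k} (h₁ : (diamondGraph.induce (diamondFilm k)).Adj x y₁) (h₂ : (diamondGraph.induce (diamondFilm k)).Adj x y₂)
    (h₃ : (diamondGraph.induce (diamondFilm k)).Adj x y₃) : y₁ = y₂ ∨ y₁ = y₃ ∨ y₂ = y₃ := by
  obtain ⟨a0, -, -⟩ := (adj_crd_iff x y₁).1 h₁
  obtain ⟨b0, -, -⟩ := (adj_crd_iff x y₂).1 h₂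
  obtain ⟨c0, -, -⟩ := (adj_crd_iff x y₃).1 h₃
  have e₁ := hℓ y₁ h₁; have e₂ := hℓ y₂ h₂; have e₃ := hℓ y₃ h₃
  by_cases h12 : crd y₁ 0 = crd y₂ 0
  · exact Or.inl (nbr_eq_of_crd_eq h₁ h₂ (by rw [e₁, e₂]) h12)
  by_cases h13 : crd y₁ 0 = crd y₃ 0
  · exact Or.inr (Or.inl (nbr_eq_of_crd_eq h₁ h₃ (by rw [e₁, e₃]) h13))
  have h23 : crd y₂ 0 = crd y₃ 0 := by omega
  exact Or.inr (Or.inr (nbr_eq_of_crd_eq h₂ h₃ (by rw [e₂, e₃]) h23))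

/-- **A vertex of a boundary layer (`x₂ = 0` or `x₂ = k`) has at most two neighbours.** [cite: ConwaySloane1999, Ch. 4 §7.3] -/
theorem at_most_two_nbrs_of_boundary {x : diamondFilm k} (hx : crd x 2 = 0 ∨ crd x 2 = k) {y₁ y₂ y₃ : diamondFilm k}
    (h₁ : (diamondGraph.induce (diamondFilm k)).Adj x y₁) (h₂ : (diamondGraph.induce (diamondFilm k)).Adj x y₂)
    (h₃ : (diamondGraph.induce (diamondFilm k)).Adj x y₃) : y₁ = y₂ ∨ y₁ = y₃ ∨ y₂ = y₃ := by
  rcases hx with hx | hx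
  · refine at_most_two_nbrs_of_height (ℓ := 1) (fun y hy => ?_) h₁ h₂ h₃
    obtain ⟨-, -, -, hy0, -⟩ := crd_facts y
    have := height_step hy; omega
  · refine at_most_two_nbrs_of_height (ℓ := (k : ℤ) - 1) (fun y hy => ?_) h₁ h₂ h₃
    obtain ⟨-, -, -, -, hyk⟩ := crd_facts y
    have := height_step hy; omega

/-- **An interior vertex (`0 < x₂ < k`) has three pairwise distinct neighbours** (two over `uv x ± eᵢ` one layer up or down, one in the other layer).
[cite: ConwaySloane1999, Ch. 4 §7.3] -/
theorem three_nbrs_of_interior {x : diamondFilm k} (h0 : 0 < crd x 2) (hk : crd x 2 < k) :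
    ∃ y₁ y₂ y₃ : diamondFilm k, (diamondGraph.induce (diamondFilm k)).Adj x y₁ ∧ (diamondGraph.induce (diamondFilm k)).Adj x y₂ ∧
      (diamondGraph.induce (diamondFilm k)).Adj x y₃ ∧ y₁ ≠ y₂ ∧ y₁ ≠ y₃ ∧ y₂ ≠ y₃ := by
  obtain ⟨-, -, -, hx0, hxk⟩ := crd_facts x
  -- the height of `x` as a natural number, and its parity
  obtain ⟨h, hh⟩ : ∃ h : ℕ, crd x 2 = h := ⟨(crd x 2).toNat, (Int.toNat_of_nonneg hx0).symm⟩
  have hpos : 1 ≤ h := by omega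
  have hlt : h + 1 ≤ k := by omega
  have single_ne : ∀ (i : Fin 2) (q : Site 2), q + (1 : ℤ) • (Pi.single i 1 : Site 2) ≠ q + (-1 : ℤ) • Pi.single i 1 := by
    intro i q heq
    have := congrFun heq i
    simp only [Pi.add_apply, Pi.smul_apply, Pi.single_eq_same, smul_eq_mul, mul_one] at this
    omega
  rcases Nat.even_or_odd h with ⟨j, hj⟩ | ⟨j, hj⟩
  · -- even height: two horizontal bonds up (lower endpoint `h` even), one vertical bond down (lower endpoint `h - 1` odd)
    have hm : ((h : ℕ) : ℤ) % 2 = 0 := by omega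
    obtain ⟨y₁, a₁, c₁, u₁⟩ := exists_adj_horiz x h hm (Or.inl hh) hlt 1 (Or.inl rfl)
    obtain ⟨y₂, a₂, c₂, u₂⟩ := exists_adj_horiz x h hm (Or.inl hh) hlt (-1) (Or.inr rfl)
    have hm' : (((h - 1 : ℕ)) : ℤ) % 2 = 1 := by omega
    obtain ⟨y₃, a₃, c₃, -⟩ := exists_adj_vert x (h - 1) hm' (Or.inr (by omega)) (by omega) 1 (Or.inl rfl)
    refine ⟨y₁, y₂, y₃, a₁, a₂, a₃, ?_, ?_, ?_⟩
    · intro e; rw [e] at u₁; exact single_ne 0 (uv x) (u₁.symm.trans u₂)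
    · intro e; rw [e] at c₁; omega
    · intro e; rw [e] at c₂; omega
  · -- odd height: two vertical bonds up (lower endpoint `h` odd), one horizontal bond down (lower endpoint `h - 1` even)
    have hm : ((h : ℕ) : ℤ) % 2 = 1 := by omega
    obtain ⟨y₁, a₁, c₁, u₁⟩ := exists_adj_vert x h hm (Or.inl hh) hlt 1 (Or.inl rfl)
    obtain ⟨y₂, a₂, c₂, u₂⟩ := exists_adj_vert x h hm (Or.inl hh) hlt (-1) (Or.inr rfl)
    have hm' : (((h - 1 : ℕ)) : ℤ) % 2 = 0 := by omega
    obtain ⟨y₃, a₃, c₃, -⟩ := exists_adj_horiz x (h - 1) hm' (Or.inr (by omega)) (by omega) 1 (Or.inl rfl)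
    refine ⟨y₁, y₂, y₃, a₁, a₂, a₃, ?_, ?_, ?_⟩
    · intro e; rw [e] at u₁; exact single_ne 1 (uv x) (u₁.symm.trans u₂)
    · intro e; rw [e] at c₁; omega
    · intro e; rw [e] at c₂; omega

/-- **Boundary layers, intrinsically**: `x₂ ∈ {0, k}` iff any three neighbours of `x` have a repetition. [cite: ConwaySloane1999, Ch. 4 §7.3] -/
theorem boundary_iff_nbrs (x : diamondFilm k) :
    (crd x 2 = 0 ∨ crd x 2 = k) ↔ ∀ y₁ y₂ y₃ : diamondFilm k, (diamondGraph.induce (diamondFilm k)).Adj x y₁ →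
      (diamondGraph.induce (diamondFilm k)).Adj x y₂ → (diamondGraph.induce (diamondFilm k)).Adj x y₃ → y₁ = y₂ ∨ y₁ = y₃ ∨ y₂ = y₃ := by
  refine ⟨fun hx y₁ y₂ y₃ h₁ h₂ h₃ => at_most_two_nbrs_of_boundary hx h₁ h₂ h₃, fun H => ?_⟩
  by_contra hx
  push Not at hx
  obtain ⟨-, -, -, hx0, hxk⟩ := crd_facts x
  obtain ⟨y₁, y₂, y₃, a₁, a₂, a₃, n12, n13, n23⟩ := three_nbrs_of_interior (x := x) (by omega) (by omega)
  rcases H y₁ y₂ y₃ a₁ a₂ a₃ with e | e | e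
  · exact n12 e
  · exact n13 e
  · exact n23 e

/-! ## §3 Automorphisms preserve the distance to the boundary layers -/

/-- **Automorphisms preserve the boundary layers** `{x₂ = 0} ∪ {x₂ = k}`. [cite: ConwaySloane1999, Ch. 4 §7.3] -/
theorem boundary_iff_of_iso (β : diamondGraph.induce (diamondFilm k) ≃g diamondGraph.induce (diamondFilm k)) (x : diamondFilm k) :
    (crd (β x) 2 = 0 ∨ crd (β x) 2 = k) ↔ (crd x 2 = 0 ∨ crd x 2 = k) := by
  rw [boundary_iff_nbrs, boundary_iff_nbrs]
  constructor
  · intro H y₁ y₂ y₃ h₁ h₂ h₃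
    rcases H (β y₁) (β y₂) (β y₃) (β.map_adj_iff.2 h₁) (β.map_adj_iff.2 h₂) (β.map_adj_iff.2 h₃) with e | e | e
    · exact Or.inl (β.injective e)
    · exact Or.inr (Or.inl (β.injective e))
    · exact Or.inr (Or.inr (β.injective e))
  · intro H y₁ y₂ y₃ h₁ h₂ h₃
    have g₁ := β.symm.map_adj_iff.2 h₁; have g₂ := β.symm.map_adj_iff.2 h₂; have g₃ := β.symm.map_adj_iff.2 h₃
    rw [RelIso.symm_apply_apply] at g₁ g₂ g₃
    rcases H _ _ _ g₁ g₂ g₃ with e | e | e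
    · exact Or.inl (β.symm.injective e)
    · exact Or.inr (Or.inl (β.symm.injective e))
    · exact Or.inr (Or.inr (β.symm.injective e))

/-- Along a bond the distance to the boundary `min x₂ (k − x₂)` changes by at most one. [folklore] -/
theorem bdist_step {x y : diamondFilm k} (h : (diamondGraph.induce (diamondFilm k)).Adj x y) :
    min (crd x 2) ((k : ℤ) - crd x 2) - min (crd y 2) ((k : ℤ) - crd y 2) ≤ 1 ∧
      min (crd y 2) ((k : ℤ) - crd y 2) - min (crd x 2) ((k : ℤ) - crd x 2) ≤ 1 := by
  have hs := height_step h
  rcases min_cases (crd x 2) ((k : ℤ) - crd x 2) with ⟨ex, cx⟩ | ⟨ex, cx⟩ <;>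
    rcases min_cases (crd y 2) ((k : ℤ) - crd y 2) with ⟨ey, cy⟩ | ⟨ey, cy⟩ <;> rw [ex, ey] <;> constructor <;> omega

/-- From a vertex at distance `m + 1` from the boundary there is a bond to a vertex at distance `m` (one step towards the nearer boundary layer). [folklore] -/
theorem exists_nbr_bdist_pred {x : diamondFilm k} {m : ℕ} (hx : min (crd x 2) ((k : ℤ) - crd x 2) = m + 1) :
    ∃ y : diamondFilm k, (diamondGraph.induce (diamondFilm k)).Adj x y ∧ min (crd y 2) ((k : ℤ) - crd y 2) = m := by
  obtain ⟨p0, p1, p2, hx0, hxk⟩ := crd_facts x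
  have hlo : (m : ℤ) + 1 ≤ crd x 2 := by rw [← hx]; exact min_le_left _ _
  have hhi : (m : ℤ) + 1 ≤ (k : ℤ) - crd x 2 := by rw [← hx]; exact min_le_right _ _
  by_cases hdown : crd x 2 ≤ (k : ℤ) - crd x 2
  · -- step down to height `x₂ - 1`
    obtain ⟨ℓ, hℓ⟩ : ∃ ℓ : ℕ, crd x 2 - 1 = ℓ := ⟨(crd x 2 - 1).toNat, (Int.toNat_of_nonneg (by omega)).symm⟩
    rcases Int.emod_two_eq_zero_or_one (crd x 2) with he | he
    · -- `x₂` even: the bond down is vertical (lower endpoint `x₂ - 1` odd)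
      obtain ⟨y, hy, c2, -⟩ := exists_adj_vert x ℓ (by omega) (Or.inr (by omega)) (by omega) 1 (Or.inl rfl)
      exact ⟨y, hy, by rw [c2]; rw [min_eq_left (by omega)]; omega⟩
    · obtain ⟨y, hy, c2, -⟩ := exists_adj_horiz x ℓ (by omega) (Or.inr (by omega)) (by omega) 1 (Or.inl rfl)
      exact ⟨y, hy, by rw [c2]; rw [min_eq_left (by omega)]; omega⟩
  · -- step up to height `x₂ + 1`
    obtain ⟨ℓ, hℓ⟩ : ∃ ℓ : ℕ, crd x 2 = ℓ := ⟨(crd x 2).toNat, (Int.toNat_of_nonneg hx0).symm⟩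
    rcases Int.emod_two_eq_zero_or_one (crd x 2) with he | he
    · obtain ⟨y, hy, c2, -⟩ := exists_adj_horiz x ℓ (by omega) (Or.inl hℓ) (by omega) 1 (Or.inl rfl)
      exact ⟨y, hy, by rw [c2]; rw [min_eq_right (by omega)]; omega⟩
    · obtain ⟨y, hy, c2, -⟩ := exists_adj_vert x ℓ (by omega) (Or.inl hℓ) (by omega) 1 (Or.inl rfl)
      exact ⟨y, hy, by rw [c2]; rw [min_eq_right (by omega)]; omega⟩

/-- **Automorphisms preserve the distance to the boundary layers** `min x₂ (k − x₂)` (induction on the distance: the boundary is intrinsic, and a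
vertex at distance `m + 1` has a neighbour at distance `m` but its image cannot be at distance `≤ m` by the induction hypothesis for the inverse).
[cite: ConwaySloane1999, Ch. 4 §7.3] -/
theorem bdist_eq_of_iso (β : diamondGraph.induce (diamondFilm k) ≃g diamondGraph.induce (diamondFilm k)) (x : diamondFilm k) :
    min (crd (β x) 2) ((k : ℤ) - crd (β x) 2) = min (crd x 2) ((k : ℤ) - crd x 2) := by
  -- strengthened statement: for every distance `j ≤ m`, every automorphism and every vertex
  suffices key : ∀ m : ℕ, ∀ j : ℕ, j ≤ m → ∀ (γ : diamondGraph.induce (diamondFilm k) ≃g diamondGraph.induce (diamondFilm k))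
      (z : diamondFilm k), min (crd z 2) ((k : ℤ) - crd z 2) = j → min (crd (γ z) 2) ((k : ℤ) - crd (γ z) 2) = j by
    obtain ⟨-, -, -, hx0, hxk⟩ := crd_facts x
    have hnn : 0 ≤ min (crd x 2) ((k : ℤ) - crd x 2) := le_min hx0 (by omega)
    obtain ⟨j, hj⟩ : ∃ j : ℕ, min (crd x 2) ((k : ℤ) - crd x 2) = j := ⟨_, (Int.toNat_of_nonneg hnn).symm⟩
    rw [hj]; exact key j j le_rfl β x hj
  have zero_iff : ∀ z : diamondFilm k, min (crd z 2) ((k : ℤ) - crd z 2) = 0 ↔ (crd z 2 = 0 ∨ crd z 2 = k) := by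
    intro z
    obtain ⟨-, -, -, hz0, hzk⟩ := crd_facts z
    rcases min_cases (crd z 2) ((k : ℤ) - crd z 2) with ⟨e, h⟩ | ⟨e, h⟩ <;> rw [e] <;> omega
  intro m
  induction m with
  | zero =>
    intro j hj γ z hz
    obtain rfl : j = 0 := Nat.le_zero.1 hj
    push_cast at hz ⊢
    exact (zero_iff (γ z)).2 ((boundary_iff_of_iso γ z).2 ((zero_iff z).1 hz))
  | succ m ih =>
    intro j hj γ z hz
    rcases Nat.lt_or_eq_of_le hj with hlt | rfl
    · exact ih j (Nat.lt_succ_iff.1 hlt) γ z hz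
    · -- `z` at distance `m + 1`: a neighbour `y` at distance `m`, whose image is at distance `m`
      push_cast at hz ⊢
      obtain ⟨y, hzy, hy⟩ := exists_nbr_bdist_pred hz
      have hγy : min (crd (γ y) 2) ((k : ℤ) - crd (γ y) 2) = m := ih m le_rfl γ y hy
      have hst := bdist_step (γ.map_adj_iff.2 hzy)
      obtain ⟨-, -, -, g0, gk⟩ := crd_facts (γ z)
      have hnn : 0 ≤ min (crd (γ z) 2) ((k : ℤ) - crd (γ z) 2) := le_min g0 (by omega)
      obtain ⟨i, hi⟩ : ∃ i : ℕ, min (crd (γ z) 2) ((k : ℤ) - crd (γ z) 2) = i := ⟨_, (Int.toNat_of_nonneg hnn).symm⟩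
      -- if the image were at distance `i ≤ m`, pull back by `γ⁻¹`
      by_contra hne
      have him : i ≤ m := by
        rw [hi] at hne hst; rw [hγy] at hst
        have : (i : ℤ) ≠ m + 1 := hne
        omega
      have back := ih i him γ.symm (γ z) hi
      rw [RelIso.symm_apply_apply, hz] at back
      have : (m : ℤ) + 1 = i := back
      omega

/-! ## §4 Odd thickness: the axis of every bond is preserved -/

/-- **For odd `k` the axis of a bond is a function of the boundary distances of its endpoints**: `x₂ + y₂ ≡ 1 (4)` iff the half-sum
`(δ(x) + δ(y)) / 2` of the two distances `δ = min x₂ (k − x₂)` is even (the layer pairs `{h, h+1}` and `{k−1−h, k−h}` exchanged by the level flip have lower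
endpoints `h` and `k−1−h`, of the same parity iff `k` is odd; the middle pair `{(k−1)/2, (k+1)/2}` is its own partner). [cite: ConwaySloane1999, Ch. 4 §7.3] -/
theorem heights_mod_four_iff_bdist (hk : Odd k) {x y : diamondFilm k} (h : (diamondGraph.induce (diamondFilm k)).Adj x y) :
    (crd x 2 + crd y 2) % 4 = 1 ↔ ((min (crd x 2) ((k : ℤ) - crd x 2) + min (crd y 2) ((k : ℤ) - crd y 2)) / 2) % 2 = 0 := by
  obtain ⟨-, -, -, hx0, hxk⟩ := crd_facts x
  obtain ⟨-, -, -, hy0, hyk⟩ := crd_facts y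
  obtain ⟨j, hj⟩ := hk
  have hk' : (k : ℤ) = 2 * j + 1 := by rw [hj]; push_cast; ring
  have hs := height_step h
  rcases min_cases (crd x 2) ((k : ℤ) - crd x 2) with ⟨ex, cx⟩ | ⟨ex, cx⟩ <;>
    rcases min_cases (crd y 2) ((k : ℤ) - crd y 2) with ⟨ey, cy⟩ | ⟨ey, cy⟩ <;> rw [ex, ey] <;> omega

/-- **AXIS RIGIDITY OF THE ODD FILMS**: for odd `k`, every graph automorphism of `D_k` maps `u`-bonds onto `u`-bonds (and `v`-bonds onto `v`-bonds) —
no automorphism exchanges the two planar directions (contrast: «DiamondFilmQuarterTurn».`rotFlipIso` for even `k`).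
[cite: DuminilCopinSidoraviciusTassion2016, §2 (the symmetries used)] [cite: ConwaySloane1999, Ch. 4 §7.3] -/
theorem uv_one_eq_iff_of_iso (hk : Odd k) (β : diamondGraph.induce (diamondFilm k) ≃g diamondGraph.induce (diamondFilm k))
    {x y : diamondFilm k} (h : (diamondGraph.induce (diamondFilm k)).Adj x y) : uv (β x) 1 = uv (β y) 1 ↔ uv x 1 = uv y 1 := by
  rw [uv_one_eq_iff_heights h, uv_one_eq_iff_heights (β.map_adj_iff.2 h), heights_mod_four_iff_bdist hk h,
    heights_mod_four_iff_bdist hk (β.map_adj_iff.2 h), bdist_eq_of_iso β x, bdist_eq_of_iso β y]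

/-- The `v`-bond version: for odd `k`, every automorphism maps `v`-bonds onto `v`-bonds. [cite: ConwaySloane1999, Ch. 4 §7.3] -/
theorem uv_zero_eq_iff_of_iso (hk : Odd k) (β : diamondGraph.induce (diamondFilm k) ≃g diamondGraph.induce (diamondFilm k))
    {x y : diamondFilm k} (h : (diamondGraph.induce (diamondFilm k)).Adj x y) : uv (β x) 0 = uv (β y) 0 ↔ uv x 0 = uv y 0 := by
  have hβ := β.map_adj_iff.2 h
  rw [uv_zero_eq_iff_heights h, uv_zero_eq_iff_heights hβ]
  have d : (crd (β x) 2 + crd (β y) 2) % 4 = 1 ↔ (crd x 2 + crd y 2) % 4 = 1 :=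
    (uv_one_eq_iff_heights hβ).symm.trans ((uv_one_eq_iff_of_iso hk β h).trans (uv_one_eq_iff_heights h))
  have sx := height_step h
  have sb := height_step hβ
  -- the two heights of a bond add up to an odd number: `1` or `3` mod `4`
  have hodd : (crd x 2 + crd y 2) % 4 = 1 ∨ (crd x 2 + crd y 2) % 4 = 3 := by rcases sx with s | s <;> omega
  have hodd' : (crd (β x) 2 + crd (β y) 2) % 4 = 1 ∨ (crd (β x) 2 + crd (β y) 2) % 4 = 3 := by rcases sb with s | s <;> omega
  constructor
  · intro H
    rcases hodd with h1 | h3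
    · exact absurd (d.2 h1) (by omega)
    · exact h3
  · intro H
    rcases hodd' with h1 | h3
    · exact absurd (d.1 h1) (by omega)
    · exact h3

/-- **NO QUARTER-TURN LIFT ON AN ODD FILM**: for odd `k` there is no graph automorphism `α` of `D_k` and no centre `c` with `uv (α w) − c = sqRot90 (uv w − c)`
for all `w` (the field `SqShadow.rot` of the square-shadow DST interface, for the planar shadow `uv`).  Proof: the bottom-layer bond from `(0,0,0)` to
`(1,1,1)` is a `u`-bond, its image would be a `v`-bond. [cite: DuminilCopinSidoraviciusTassion2016, §2 (p. 2: "invariant under π/2-rotation and reflection")]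
[cite: ConwaySloane1999, Ch. 4 §7.3] -/
theorem not_exists_rot_lift (hk : Odd k) (c : Site 2) :
    ¬ ∃ α : diamondGraph.induce (diamondFilm k) ≃g diamondGraph.induce (diamondFilm k), ∀ w, uv (α w) - c = sqRot90 (uv w - c) := by
  rintro ⟨α, hα⟩
  have hk1 : 0 + 1 ≤ k := by have := hk.pos; omega
  -- the vertex `(0,0,0)` of the bottom layer and its `u`-neighbour at height `1`
  have hfit : (0 : ℤ) % 2 = ((0 : ℕ) : ℤ) % 2 ∧ (0 : ℤ) % 2 = ((0 : ℕ) : ℤ) % 2 ∧ (((0 : ℤ) + 0 + ((0 : ℕ) : ℤ)) % 4 = 0 ∨ ((0 : ℤ) + 0 + ((0 : ℕ) : ℤ)) % 4 = 3) :=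
    ⟨by decide, by decide, Or.inl (by decide)⟩
  obtain ⟨-, -, cx2⟩ := crd_mkV (k := k) 0 0 0 hfit (Nat.zero_le k)
  obtain ⟨y, hxy, -, huv⟩ := exists_adj_horiz (mkV (k := k) 0 0 0 hfit (Nat.zero_le k)) 0 (by decide) (Or.inl cx2) hk1 1 (Or.inl rfl)
  have hu1 : uv y 1 = uv (mkV (k := k) 0 0 0 hfit (Nat.zero_le k)) 1 := by
    have e := congrFun huv 1
    simp only [Pi.add_apply, Pi.smul_apply, Pi.single_eq_of_ne (by decide : (1 : Fin 2) ≠ 0), smul_zero, add_zero] at e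
    exact e
  have hu0 : uv y 0 = uv (mkV (k := k) 0 0 0 hfit (Nat.zero_le k)) 0 + 1 := by
    have e := congrFun huv 0
    simp only [Pi.add_apply, Pi.smul_apply, Pi.single_eq_same, smul_eq_mul, mul_one] at e
    exact e
  -- the image bond is again a `u`-bond ...
  have himg : uv (α (mkV (k := k) 0 0 0 hfit (Nat.zero_le k))) 1 = uv (α y) 1 := (uv_one_eq_iff_of_iso hk α hxy).2 hu1.symm
  -- ... but the quarter turn makes it a `v`-bond
  have ex := congrFun (hα (mkV (k := k) 0 0 0 hfit (Nat.zero_le k))) 1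
  have ey := congrFun (hα y) 1
  simp only [Pi.sub_apply, sqRot90_apply_one] at ex ey
  omega

/-- **THE SQUARE-SHADOW DST INTERFACE HAS NO INSTANCE ON AN ODD FILM WITH THE PLANAR SHADOW**: for odd `k`, every `Ψ : SqShadow (D_k)` has `Ψ.sh ≠ uv`
(its field `rot` would be a quarter-turn lift).  This is the kernel form of memo §142 (4) "method-void: only the rectangle group `D₂` acts on the shadow";
for even `k` the instance is «DiamondFilmSqShadow».`sqShadow`. [cite: DuminilCopinSidoraviciusTassion2016, §2 (p. 2: "invariant under π/2-rotation and reflection")]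
[cite: BenjaminiSchramm1996, Conj. 4 / Question 3] -/
theorem sqShadow_sh_ne_uv (hk : Odd k) (Ψ : SqShadow (diamondGraph.induce (diamondFilm k))) : Ψ.sh ≠ uv := by
  intro h
  obtain ⟨α, hα⟩ := Ψ.rot
  exact not_exists_rot_lift hk Ψ.centre ⟨α, fun w => by rw [← h]; exact hα w⟩


/-- **Along a `u`-bond the shadow moves by exactly `±e₀`** (vector form of «DiamondFilmQuarterTurn».`uv_step`). [cite: ConwaySloane1999, Ch. 4 §7.3] -/
theorem uv_sub_eq_of_uBond {x y : diamondFilm k} (h : (diamondGraph.induce (diamondFilm k)).Adj x y) (h1 : uv x 1 = uv y 1) :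
    uv x - uv y = Pi.single 0 1 ∨ uv x - uv y = -Pi.single 0 1 := by
  rcases uv_step h with ⟨-, h0 | h0⟩ | ⟨-, h1' | h1'⟩
  · left; ext i; fin_cases i <;> [simpa using h0; simp [h1]]
  · right; ext i; fin_cases i <;> [simpa using h0; simp [h1]]
  all_goals exfalso; omega

/-- **NO LINEAR RE-COORDINATISATION HELPS**: for odd `k`, no `Ψ : SqShadow (D_k)` has a shadow `sh = A ∘ uv + t` with `A : ℤ² →+ ℤ²` injective (`A ∈ GL₂(ℤ)`,
shears, dilations …).  Proof: the lifted quarter turn maps the bottom `u`-bond to a `u`-bond (`uv_one_eq_iff_of_iso`), so `v = A e₀` has `sqRot90 v = ±v`, `v = 0`.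
[cite: DuminilCopinSidoraviciusTassion2016, §2 (p. 2: "invariant under π/2-rotation and reflection")] [cite: ConwaySloane1999, Ch. 4 §7.3] -/
theorem sqShadow_sh_ne_linear_uv (hk : Odd k) (Ψ : SqShadow (diamondGraph.induce (diamondFilm k))) (A : Site 2 →+ Site 2)
    (hA : Function.Injective A) (t : Site 2) : ¬ ∀ w, Ψ.sh w = A (uv w) + t := by
  intro hsh
  obtain ⟨α, hα⟩ := Ψ.rot
  have hk1 : 0 + 1 ≤ k := by have := hk.pos; omega
  have hfit : (0 : ℤ) % 2 = ((0 : ℕ) : ℤ) % 2 ∧ (0 : ℤ) % 2 = ((0 : ℕ) : ℤ) % 2 ∧ (((0 : ℤ) + 0 + ((0 : ℕ) : ℤ)) % 4 = 0 ∨ ((0 : ℤ) + 0 + ((0 : ℕ) : ℤ)) % 4 = 3) :=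
    ⟨by decide, by decide, Or.inl (by decide)⟩
  obtain ⟨x, cx2⟩ : ∃ x : diamondFilm k, crd x 2 = ((0 : ℕ) : ℤ) := ⟨mkV 0 0 0 hfit (Nat.zero_le k), (crd_mkV (k := k) 0 0 0 hfit (Nat.zero_le k)).2.2⟩
  obtain ⟨y, hxy, -, huv⟩ := exists_adj_horiz x 0 (by decide) (Or.inl cx2) hk1 1 (Or.inl rfl)
  -- the bottom bond `{x, y}` is a `u`-bond with `uv x − uv y = −e₀`; so is its image under `α`
  have hd : uv x - uv y = -Pi.single 0 1 := by rw [huv, one_smul]; abel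
  have hu1 : uv x 1 = uv y 1 := by
    have e := congrFun hd 1
    simp only [Pi.sub_apply, Pi.neg_apply, Pi.single_eq_of_ne (by decide : (1 : Fin 2) ≠ 0), neg_zero] at e; omega
  have himg := uv_sub_eq_of_uBond (α.map_adj_iff.2 hxy) ((uv_one_eq_iff_of_iso hk α hxy).2 hu1)
  -- the quarter-turn relation differenced along the bond: `A (uv (α x) − uv (α y)) = sqRot90 (A (uv x − uv y)) = sqRot90 (−A e₀)`
  have ex := hα x; have ey := hα y; rw [hsh, hsh] at ex ey
  have key : A (uv (α x)) + t - Ψ.centre - (A (uv (α y)) + t - Ψ.centre) = sqRot90 (A (uv x) + t - Ψ.centre) - sqRot90 (A (uv y) + t - Ψ.centre) := by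
    rw [ex, ey]
  rw [← sqRot90_sub, show A (uv x) + t - Ψ.centre - (A (uv y) + t - Ψ.centre) = A (uv x - uv y) by rw [map_sub]; abel,
    show A (uv (α x)) + t - Ψ.centre - (A (uv (α y)) + t - Ψ.centre) = A (uv (α x) - uv (α y)) by rw [map_sub]; abel, hd, map_neg] at key
  -- `A e₀` is an eigenvector of the quarter turn, hence zero — contradicting injectivity
  have hv0 : A (Pi.single 0 1 : Site 2) = 0 := by
    rcases himg with e | e <;> rw [e] at key <;> [skip; rw [map_neg] at key] <;>
      have k0 := congrFun key 0 <;> have k1 := congrFun key 1 <;>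
      simp only [sqRot90_apply_zero, sqRot90_apply_one, Pi.neg_apply, neg_neg] at k0 k1 <;> ext i <;> fin_cases i
    · show A (Pi.single 0 1) 0 = 0; omega
    · show A (Pi.single 0 1) 1 = 0; omega
    · show A (Pi.single 0 1) 0 = 0; omega
    · show A (Pi.single 0 1) 1 = 0; omega
  have h0 := congrFun (hA (by rw [map_zero]; exact hv0) : (Pi.single 0 1 : Site 2) = 0) 0
  simp at h0

end DiamondFilm

end Summit.CriticalPhenomena.PercolationContinuityZ3.Theorems.Transplant

end
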